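import Literature.Topology.FourManifolds.LatticeFormsEichlerFrames
import Mathlib.Tactic.Module
import HarnessLib

/-!
# Full-frame transport by words in Kirby's generators over the odd core `⟨1⟩ ⊕ ⟨-1⟩` (Wall 1964, p. 145; Kirby 1989, Ch. X)

Topic `Literature/Topology/FourManifolds`; sequel of `LatticeFormsEichlerFrames.lean` (fact seat
of `Literature.Topology.FourManifolds.isHCobordant_of_equivalent_intersectionForm`, Wall's
theorem on h-cobordism: C. T. C. Wall, *On simply-connected 4-manifolds*, J. London Math. Soc.
39 (1964), Thm. 2 and §2, p. 145, "for some automorph `T` of `H₂(∂V)`, `T(L) = K` … by [11]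
there is a diffeomorphism of `∂V` which induces `T`"; R. C. Kirby, *The topology of
4-manifolds*, LNM 1374 (1989), Ch. X, proofs of Thm. 1 (p. 56) and Thm. 2 (pp. 61–62), whose
generators `A_a`, `A'_a`, `1 ⊕ O(H)` are the tree's `wallGenerators`).

`LatticeFormsEichlerFrames.lean` transports hyperbolic frames of `Q ⊕ H` by WORDS in Kirby's
generators of the one summand `H` (no generation theorem for `O(Q ⊕ H)`), as long as either a
spare hyperbolic plane exists (`exists_isWordIn_wallGenerators_apply_eq_of_frame`) or the target
planes and `H` exhaust the lattice (`…_of_fullFrame`, core `0`).  This file adds the case of the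
smallest ODD core: the target planes, `H`, and two vectors `p`, `q` with `p·p = 1`, `q·q = -1`,
`p·q = 0` exhaust the lattice (`Q ≅ ⟨1⟩ ⊕ ⟨-1⟩ ⊕ K·H`, the lattice of
`(ℂℙ² # -ℂℙ²) # K(S² × S²)`):

* `exists_isWordIn_wallGenerators_endgame_odd` — **the odd endgame**: a vector
  `w = s + α p + β q + γ x + δ y` (`s` a sum along the placed isotropic `y_j`) which is isotropic
  and has an isotropic dual vector of the same shape is carried to `y` by a word in Kirby's
  generators fixing every `y_j`.  The word is found by an explicit DESCENT using only the
  transvections `A_a`, `A'_a` with `a ∈ {t(p+q), t(p-q)}` (isotropic arguments, `q = 0`) and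
  `1 ⊕ O(H)` (swap, `-1`): in the coordinates `m = (α-β)/2`, `m' = (α+β)/2` one has
  `γ δ = -2 m m'`, the four transvections change `(m, m', γ, δ)` by
  `m' ↦ m' + tγ`, `m ↦ m + tγ`, `m' ↦ m' + tδ`, `m ↦ m + tδ` (and correct the other
  coordinate of `H`), so `|m|, |m'| ≤ |γ|/2` can be arranged, forcing `|δ| ≤ |γ|/2`; swapping and
  repeating terminates at `δ = 0`, where `m m' = 0` and a Euclidean algorithm on the surviving
  pair `(m', γ)` (coprime with `γ` odd, by the dual vector) ends at `w = s ± x` or `s ± y`,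
  finished as in the even endgame (`A'_{-s}` removes `s`).  Even-type-ness of `w` (it has an
  isotropic dual) is what excludes the odd-type isotropic vectors `±(p ± q)`, which are NOT in
  the orbit of `y`;
* `exists_isWordIn_wallGenerators_apply_eq_std_of_fullFrame_odd`,
  `exists_isWordIn_wallGenerators_apply_eq_of_fullFrame_odd` — the full-frame transport over the
  odd core: the isotropic half of every hyperbolic `(K+1)`-frame is carried onto
  `(y_0, …, y_{K-1}, y)` by a word in `wallGenerators`, and for every isometry `A` some word
  agrees with `A` on the isotropic half of the frame.

Consumers: the Lagrangian mover of Wall's trick for ODD forms (the analogue of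
`HCobordismWallTrickEven.lean`) and the regluing of Route K over the core `⟨1⟩ ⊕ ⟨-1⟩`.
Everything is proved; no named fact is introduced (D-0026).

## References

* C. T. C. Wall, *On simply-connected 4-manifolds*, J. London Math. Soc. 39 (1964) 141–149, §2,
  p. 145. [WallJLMS1964]
* R. C. Kirby, *The topology of 4-manifolds*, LNM 1374 (1989), Ch. X, proof of Thm. 1 (p. 56) and
  of Thm. 2 (pp. 61–62). [Kirby1989]
* V. Gritsenko, K. Hulek, G. K. Sankaran, *Abelianisation of orthogonal groups and the
  fundamental group of modular varieties*, J. Algebra 322 (2009) 463–478, §3, Prop. 3.3.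
  [GritsenkoHulekSankaran2009]
-/

noncomputable section

open Module
open LinearMap (BilinForm)

namespace Literature.Topology.FourManifolds

variable {V : Type*} [AddCommGroup V] {Q : BilinForm ℤ V}

/-- Local notation for the form `Q ⊕ H` on `V × (Fin 2 → ℤ)`. -/
local notation "QH" => (Q.prod hyperbolicForm)

/-! ### An integer lemma: division with centred remainder -/

/-- Division with a centred remainder: `|a - t b| ≤ |b| / 2` for some `t`, `b ≠ 0`. [folklore] -/
theorem Int.exists_two_mul_abs_sub_mul_le (a b : ℤ) (hb : b ≠ 0) :
    ∃ t : ℤ, 2 * |a - t * b| ≤ |b| := by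
  -- reduce to `b > 0`
  suffices h : ∀ c : ℤ, 0 < c → ∃ t : ℤ, 2 * |a - t * c| ≤ c by
    rcases lt_or_gt_of_ne hb with hneg | hpos
    · obtain ⟨t, ht⟩ := h (-b) (neg_pos.2 hneg)
      refine ⟨-t, ?_⟩
      rw [abs_of_neg hneg]
      calc 2 * |a - -t * b| = 2 * |a - t * -b| := by ring_nf
        _ ≤ -b := ht
    · obtain ⟨t, ht⟩ := h b hpos
      exact ⟨t, by rwa [abs_of_pos hpos]⟩
  intro c hc
  set r := a % c with hr
  set t₀ := a / c with ht₀
  have hdiv : r + c * t₀ = a := Int.emod_add_mul_ediv a c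
  have hr0 : 0 ≤ r := Int.emod_nonneg a hc.ne'
  have hrc : r < c := Int.emod_lt_of_pos a hc
  by_cases h2 : 2 * r ≤ c
  · refine ⟨t₀, ?_⟩
    have hsub : a - t₀ * c = r := by rw [← hdiv]; ring
    rw [hsub, abs_of_nonneg hr0]
    exact h2
  · refine ⟨t₀ + 1, ?_⟩
    have hsub : a - (t₀ + 1) * c = r - c := by rw [← hdiv]; ring
    rw [hsub, abs_of_nonpos (by omega)]
    omega

/-- Parity: if `a² - b²` is even then `a - b` is even. [folklore] -/
theorem Int.even_sub_of_even_sq_sub_sq {a b : ℤ} (h : Even (a * a - b * b)) : Even (a - b) := by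
  have hprod : a * a - b * b = (a - b) * (a + b) := by ring
  rw [hprod, Int.even_mul] at h
  rcases h with h | h
  · exact h
  · have h2 : a - b = (a + b) - 2 * b := by ring
    rw [h2]
    exact h.sub (even_two_mul b)

/-! ### The normal form `s + α p + β q + γ x + δ y` and the action of the generators on it -/

section NormalForm

variable (sV pV qV : V)

/-- The normal form `(s, 0) + α (p, 0) + β (q, 0) + γ x + δ y` of a vector of `Q ⊕ H` relative
to the odd core `p`, `q` (`p·p = 1`, `q·q = -1`). [folklore] -/
def oddNF (α β γ δ : ℤ) : V × (Fin 2 → ℤ) :=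
  ((sV, 0) : V × (Fin 2 → ℤ)) + α • ((pV, 0) : V × (Fin 2 → ℤ)) + β • ((qV, 0) : V × (Fin 2 → ℤ)) +
    γ • hypX + δ • hypY

variable {sV pV qV}

/-- `y · nf = γ`. [folklore] -/
theorem prod_hyperbolic_hypY_oddNF (α β γ δ : ℤ) : QH hypY (oddNF sV pV qV α β γ δ) = γ := by
  simp only [oddNF, map_add, map_smul, smul_eq_mul, prod_hyperbolic_hypY_inl,
    prod_hyperbolic_hypY_hypX, prod_hyperbolic_hypY_hypY]
  ring

/-- `x · nf = δ`. [folklore] -/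
theorem prod_hyperbolic_hypX_oddNF (α β γ δ : ℤ) : QH hypX (oddNF sV pV qV α β γ δ) = δ := by
  simp only [oddNF, map_add, map_smul, smul_eq_mul, prod_hyperbolic_hypX_inl,
    prod_hyperbolic_hypX_hypX, prod_hyperbolic_hypX_hypY]
  ring

/-- `(w, 0) · nf = w·s + α w·p + β w·q`. [folklore] -/
theorem prod_hyperbolic_inl_oddNF (w : V) (α β γ δ : ℤ) :
    QH ((w, 0) : V × (Fin 2 → ℤ)) (oddNF sV pV qV α β γ δ) = Q w sV + α * Q w pV + β * Q w qV := by
  simp only [oddNF, map_add, map_smul, smul_eq_mul, prod_hyperbolic_inl_inl,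
    prod_hyperbolic_inl_hypX, prod_hyperbolic_inl_hypY]
  ring

variable (hpp : Q pV pV = 1) (hqq : Q qV qV = -1) (hpq : Q pV qV = 0) (hqp : Q qV pV = 0)
  (hps : Q pV sV = 0) (hqs : Q qV sV = 0)
include hpp hqq hpq hqp hps hqs

/-- `t(p + q) · nf = t (α - β)`. [folklore] -/
theorem prod_hyperbolic_smul_add_oddNF (t α β γ δ : ℤ) :
    QH ((t • (pV + qV), 0) : V × (Fin 2 → ℤ)) (oddNF sV pV qV α β γ δ) = t * (α - β) := by
  rw [prod_hyperbolic_inl_oddNF]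
  simp only [map_add, map_smul, LinearMap.add_apply, LinearMap.smul_apply, smul_eq_mul, hpp, hqq,
    hpq, hqp, hps, hqs]
  ring

/-- `t(p - q) · nf = t (α + β)`. [folklore] -/
theorem prod_hyperbolic_smul_sub_oddNF (t α β γ δ : ℤ) :
    QH ((t • (pV - qV), 0) : V × (Fin 2 → ℤ)) (oddNF sV pV qV α β γ δ) = t * (α + β) := by
  rw [prod_hyperbolic_inl_oddNF]
  simp only [map_sub, map_smul, LinearMap.sub_apply, LinearMap.smul_apply, smul_eq_mul, hpp, hqq,
    hpq, hqp, hps, hqs]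
  ring

omit hps hqs in
/-- `t(p + q)` is isotropic. [folklore] -/
theorem apply_smul_add_self (t : ℤ) : Q (t • (pV + qV)) (t • (pV + qV)) = 0 + 0 := by
  simp only [map_add, map_smul, LinearMap.add_apply, LinearMap.smul_apply, smul_eq_mul, hpp, hqq,
    hpq, hqp]
  ring

omit hps hqs in
/-- `t(p - q)` is isotropic. [folklore] -/
theorem apply_smul_sub_self (t : ℤ) : Q (t • (pV - qV)) (t • (pV - qV)) = 0 + 0 := by
  simp only [map_sub, map_smul, LinearMap.sub_apply, LinearMap.smul_apply, smul_eq_mul, hpp, hqq,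
    hpq, hqp]
  ring

/-- **`A_{t(p+q)}` on the normal form**: `(α, β, γ, δ) ↦ (α + tγ, β + tγ, γ, δ - t(α - β))`. [cite: Kirby1989, Ch. X, proof of Thm. 2 (p. 62)] -/
theorem transvectionA_smul_add_oddNF (t α β γ δ : ℤ) :
    transvectionA Q (t • (pV + qV)) 0 (oddNF sV pV qV α β γ δ) =
      oddNF sV pV qV (α + t * γ) (β + t * γ) γ (δ - t * (α - β)) := by
  rw [transvectionA, LinearMap.BilinForm.eichlerTransvection_apply, prod_hyperbolic_hypY_oddNF,
    prod_hyperbolic_smul_add_oddNF hpp hqq hpq hqp hps hqs, zero_mul, zero_smul, sub_zero]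
  have h : ((t • (pV + qV), (0 : Fin 2 → ℤ)) : V × (Fin 2 → ℤ)) =
      t • (((pV, 0) : V × (Fin 2 → ℤ)) + ((qV, 0) : V × (Fin 2 → ℤ))) := by
    rw [Prod.mk_add_mk, add_zero, Prod.smul_mk, smul_zero]
  rw [h]
  simp only [oddNF]
  module

/-- **`A_{t(p-q)}` on the normal form**: `(α, β, γ, δ) ↦ (α + tγ, β - tγ, γ, δ - t(α + β))`. [cite: Kirby1989, Ch. X, proof of Thm. 2 (p. 62)] -/
theorem transvectionA_smul_sub_oddNF (t α β γ δ : ℤ) :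
    transvectionA Q (t • (pV - qV)) 0 (oddNF sV pV qV α β γ δ) =
      oddNF sV pV qV (α + t * γ) (β - t * γ) γ (δ - t * (α + β)) := by
  rw [transvectionA, LinearMap.BilinForm.eichlerTransvection_apply, prod_hyperbolic_hypY_oddNF,
    prod_hyperbolic_smul_sub_oddNF hpp hqq hpq hqp hps hqs, zero_mul, zero_smul, sub_zero]
  have h : ((t • (pV - qV), (0 : Fin 2 → ℤ)) : V × (Fin 2 → ℤ)) =
      t • (((pV, 0) : V × (Fin 2 → ℤ)) - ((qV, 0) : V × (Fin 2 → ℤ))) := by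
    rw [Prod.mk_sub_mk, sub_zero, Prod.smul_mk, smul_zero]
  rw [h]
  simp only [oddNF]
  module

/-- **`A'_{t(p+q)}` on the normal form**: `(α, β, γ, δ) ↦ (α + tδ, β + tδ, γ - t(α - β), δ)`. [cite: Kirby1989, Ch. X, proof of Thm. 2 (p. 62)] -/
theorem transvectionA'_smul_add_oddNF (t α β γ δ : ℤ) :
    transvectionA' Q (t • (pV + qV)) 0 (oddNF sV pV qV α β γ δ) =
      oddNF sV pV qV (α + t * δ) (β + t * δ) (γ - t * (α - β)) δ := by
  rw [transvectionA', LinearMap.BilinForm.eichlerTransvection_apply, prod_hyperbolic_hypX_oddNF,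
    prod_hyperbolic_smul_add_oddNF hpp hqq hpq hqp hps hqs, zero_mul, zero_smul, sub_zero]
  have h : ((t • (pV + qV), (0 : Fin 2 → ℤ)) : V × (Fin 2 → ℤ)) =
      t • (((pV, 0) : V × (Fin 2 → ℤ)) + ((qV, 0) : V × (Fin 2 → ℤ))) := by
    rw [Prod.mk_add_mk, add_zero, Prod.smul_mk, smul_zero]
  rw [h]
  simp only [oddNF]
  module

/-- **`A'_{t(p-q)}` on the normal form**: `(α, β, γ, δ) ↦ (α + tδ, β - tδ, γ - t(α + β), δ)`. [cite: Kirby1989, Ch. X, proof of Thm. 2 (p. 62)] -/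
theorem transvectionA'_smul_sub_oddNF (t α β γ δ : ℤ) :
    transvectionA' Q (t • (pV - qV)) 0 (oddNF sV pV qV α β γ δ) =
      oddNF sV pV qV (α + t * δ) (β - t * δ) (γ - t * (α + β)) δ := by
  rw [transvectionA', LinearMap.BilinForm.eichlerTransvection_apply, prod_hyperbolic_hypX_oddNF,
    prod_hyperbolic_smul_sub_oddNF hpp hqq hpq hqp hps hqs, zero_mul, zero_smul, sub_zero]
  have h : ((t • (pV - qV), (0 : Fin 2 → ℤ)) : V × (Fin 2 → ℤ)) =
      t • (((pV, 0) : V × (Fin 2 → ℤ)) - ((qV, 0) : V × (Fin 2 → ℤ))) := by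
    rw [Prod.mk_sub_mk, sub_zero, Prod.smul_mk, smul_zero]
  rw [h]
  simp only [oddNF]
  module

end NormalForm

/-- **The swap `1 ⊕ σ` on the normal form**: `(α, β, γ, δ) ↦ (α, β, δ, γ)`. [cite: Kirby1989, Ch. X, proof of Thm. 2 (p. 62)] -/
theorem prodCongr_hyperbolicSwap_oddNF (sV pV qV : V) (α β γ δ : ℤ) :
    (LinearMap.BilinForm.IsometryEquiv.refl Q).prodCongr hyperbolicSwap (oddNF sV pV qV α β γ δ) =
      oddNF sV pV qV α β δ γ := by
  rw [LinearMap.BilinForm.IsometryEquiv.prodCongr_apply]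
  refine Prod.ext ?_ ?_
  · simp [oddNF, hypX, hypY]
  · ext i
    fin_cases i <;> simp [oddNF, hypX, hypY, hyperbolicSwap_apply]

/-- **`1 ⊕ (-1)` on the normal form**: `(α, β, γ, δ) ↦ (α, β, -γ, -δ)`. [cite: Kirby1989, Ch. X, proof of Thm. 2 (p. 62)] -/
theorem prodCongr_neg_oddNF (sV pV qV : V) (α β γ δ : ℤ) :
    (LinearMap.BilinForm.IsometryEquiv.refl Q).prodCongr
        (LinearMap.BilinForm.IsometryEquiv.neg hyperbolicForm) (oddNF sV pV qV α β γ δ) =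
      oddNF sV pV qV α β (-γ) (-δ) := by
  rw [LinearMap.BilinForm.IsometryEquiv.prodCongr_apply]
  refine Prod.ext ?_ ?_
  · simp [oddNF, hypX, hypY]
  · ext i
    fin_cases i <;> simp [oddNF, hypX, hypY, LinearMap.BilinForm.IsometryEquiv.neg_apply]

/-! ### The descent -/

section Endgame

variable {K : ℕ}

/-- **Reachability**: the normal form with coefficients `(α, β, γ, δ)` (relative to fixed `s`, `p`,
`q`) is carried to `y` by a word in Kirby's generators fixing the placed `y_j`. [folklore] -/
def OddReach (hQ : Q.IsSymm) (ys : Fin K → V × (Fin 2 → ℤ)) (sV pV qV : V) (α β γ δ : ℤ) : Prop :=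
  ∃ η : (QH).IsometryEquiv QH, IsWordIn (wallGenerators hQ) η ∧ (∀ j, η (ys j) = ys j) ∧
    η (oddNF sV pV qV α β γ δ) = hypY

variable {hQ : Q.IsSymm} {ys : Fin K → V × (Fin 2 → ℤ)} {sV pV qV : V}

/-- Transport of reachability along equal coefficients. [folklore] -/
theorem OddReach.congr {α β γ δ α' β' γ' δ' : ℤ} (h : OddReach hQ ys sV pV qV α β γ δ)
    (hα : α = α') (hβ : β = β') (hγ : γ = γ') (hδ : δ = δ') : OddReach hQ ys sV pV qV α' β' γ' δ' := by
  subst hα hβ hγ hδ; exact h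

/-- The swap `1 ⊕ σ`: reachability of `(α, β, δ, γ)` gives that of `(α, β, γ, δ)`. [cite: Kirby1989, Ch. X, proof of Thm. 2 (p. 62)] -/
theorem OddReach.of_swap (hy0 : ∀ j, ys j = ((ys j).1, 0)) {α β γ δ : ℤ}
    (h : OddReach hQ ys sV pV qV α β δ γ) : OddReach hQ ys sV pV qV α β γ δ := by
  obtain ⟨η, hη, hηy, hηw⟩ := h
  set S := (LinearMap.BilinForm.IsometryEquiv.refl Q).prodCongr hyperbolicSwap with hSdef
  have hS : IsWordIn (wallGenerators hQ) S := IsWordIn.of_mem (prodCongr_refl_mem_wallGenerators hQ _)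
  have hSy : ∀ j, S (ys j) = ys j := fun j => by
    rw [hy0 j, hSdef, LinearMap.BilinForm.IsometryEquiv.prodCongr_apply]
    refine Prod.ext rfl ?_
    ext i; fin_cases i <;> simp [hyperbolicSwap_apply]
  refine ⟨S.trans η, hS.trans hη, fun j => by
    rw [LinearMap.BilinForm.IsometryEquiv.trans_apply, hSy, hηy], ?_⟩
  rw [LinearMap.BilinForm.IsometryEquiv.trans_apply, hSdef, prodCongr_hyperbolicSwap_oddNF, hηw]

/-- `1 ⊕ (-1)`: reachability of `(α, β, -γ, -δ)` gives that of `(α, β, γ, δ)`. [cite: Kirby1989, Ch. X, proof of Thm. 2 (p. 62)] -/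
theorem OddReach.of_neg (hy0 : ∀ j, ys j = ((ys j).1, 0)) {α β γ δ : ℤ}
    (h : OddReach hQ ys sV pV qV α β (-γ) (-δ)) : OddReach hQ ys sV pV qV α β γ δ := by
  obtain ⟨η, hη, hηy, hηw⟩ := h
  set N := (LinearMap.BilinForm.IsometryEquiv.refl Q).prodCongr
    (LinearMap.BilinForm.IsometryEquiv.neg hyperbolicForm) with hNdef
  have hN : IsWordIn (wallGenerators hQ) N := IsWordIn.of_mem (prodCongr_refl_mem_wallGenerators hQ _)
  have hNy : ∀ j, N (ys j) = ys j := fun j => by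
    rw [hy0 j, hNdef, LinearMap.BilinForm.IsometryEquiv.prodCongr_apply]
    refine Prod.ext rfl ?_
    change -(0 : Fin 2 → ℤ) = 0
    exact neg_zero
  refine ⟨N.trans η, hN.trans hη, fun j => by
    rw [LinearMap.BilinForm.IsometryEquiv.trans_apply, hNy, hηy], ?_⟩
  rw [LinearMap.BilinForm.IsometryEquiv.trans_apply, hNdef, prodCongr_neg_oddNF, hηw]

variable (hpp : Q pV pV = 1) (hqq : Q qV qV = -1) (hpq : Q pV qV = 0) (hqp : Q qV pV = 0)
  (hps : Q pV sV = 0) (hqs : Q qV sV = 0) (hy0 : ∀ j, ys j = ((ys j).1, 0))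
  (hpy : ∀ j, Q pV (ys j).1 = 0) (hqy : ∀ j, Q qV (ys j).1 = 0)
include hpp hqq hpq hqp hps hqs hy0 hpy hqy

omit hpp hqq hpq hqp hps hqs in
/-- The transvections `A_{t(p ± q)}`, `A'_{t(p ± q)}` fix the placed `y_j`. [folklore] -/
theorem transvection_core_apply_ys (t : ℤ) (j : Fin K) :
    transvectionA Q (t • (pV + qV)) 0 (ys j) = ys j ∧ transvectionA Q (t • (pV - qV)) 0 (ys j) = ys j ∧
      transvectionA' Q (t • (pV + qV)) 0 (ys j) = ys j ∧
        transvectionA' Q (t • (pV - qV)) 0 (ys j) = ys j := by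
  have h₁ : Q (t • (pV + qV)) (ys j).1 = 0 := by
    simp only [map_add, map_smul, LinearMap.add_apply, LinearMap.smul_apply, smul_eq_mul, hpy, hqy]
    ring
  have h₂ : Q (t • (pV - qV)) (ys j).1 = 0 := by
    simp only [map_sub, map_smul, LinearMap.sub_apply, LinearMap.smul_apply, smul_eq_mul, hpy, hqy]
    ring
  refine ⟨?_, ?_, ?_, ?_⟩
  · rw [hy0 j, transvectionA_inl, h₁, zero_smul, sub_zero]
  · rw [hy0 j, transvectionA_inl, h₂, zero_smul, sub_zero]
  · rw [hy0 j, transvectionA'_inl, h₁, zero_smul, sub_zero]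
  · rw [hy0 j, transvectionA'_inl, h₂, zero_smul, sub_zero]

/-- `A_{t(p+q)}`: reachability of `(α + tγ, β + tγ, γ, δ - t(α-β))` gives that of `(α, β, γ, δ)`.
[cite: Kirby1989, Ch. X, proof of Thm. 2 (p. 62)] -/
theorem OddReach.of_transvectionA_add (t : ℤ) {α β γ δ : ℤ}
    (h : OddReach hQ ys sV pV qV (α + t * γ) (β + t * γ) γ (δ - t * (α - β))) :
    OddReach hQ ys sV pV qV α β γ δ := by
  obtain ⟨η, hη, hηy, hηw⟩ := h
  set G := transvectionAEquiv hQ (t • (pV + qV)) 0 (apply_smul_add_self hpp hqq hpq hqp t) with hG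
  refine ⟨G.trans η, (IsWordIn.of_mem (transvectionAEquiv_mem_wallGenerators hQ _ _ _)).trans hη,
    fun j => ?_, ?_⟩
  · rw [LinearMap.BilinForm.IsometryEquiv.trans_apply, hG, transvectionAEquiv_apply,
      (transvection_core_apply_ys hy0 hpy hqy t j).1, hηy]
  · rw [LinearMap.BilinForm.IsometryEquiv.trans_apply, hG, transvectionAEquiv_apply,
      transvectionA_smul_add_oddNF hpp hqq hpq hqp hps hqs, hηw]

/-- `A_{t(p-q)}`: reachability of `(α + tγ, β - tγ, γ, δ - t(α+β))` gives that of `(α, β, γ, δ)`.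
[cite: Kirby1989, Ch. X, proof of Thm. 2 (p. 62)] -/
theorem OddReach.of_transvectionA_sub (t : ℤ) {α β γ δ : ℤ}
    (h : OddReach hQ ys sV pV qV (α + t * γ) (β - t * γ) γ (δ - t * (α + β))) :
    OddReach hQ ys sV pV qV α β γ δ := by
  obtain ⟨η, hη, hηy, hηw⟩ := h
  set G := transvectionAEquiv hQ (t • (pV - qV)) 0 (apply_smul_sub_self hpp hqq hpq hqp t) with hG
  refine ⟨G.trans η, (IsWordIn.of_mem (transvectionAEquiv_mem_wallGenerators hQ _ _ _)).trans hη,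
    fun j => ?_, ?_⟩
  · rw [LinearMap.BilinForm.IsometryEquiv.trans_apply, hG, transvectionAEquiv_apply,
      (transvection_core_apply_ys hy0 hpy hqy t j).2.1, hηy]
  · rw [LinearMap.BilinForm.IsometryEquiv.trans_apply, hG, transvectionAEquiv_apply,
      transvectionA_smul_sub_oddNF hpp hqq hpq hqp hps hqs, hηw]

/-- `A'_{t(p+q)}`: reachability of `(α + tδ, β + tδ, γ - t(α-β), δ)` gives that of `(α, β, γ, δ)`.
[cite: Kirby1989, Ch. X, proof of Thm. 2 (p. 62)] -/
theorem OddReach.of_transvectionA'_add (t : ℤ) {α β γ δ : ℤ}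
    (h : OddReach hQ ys sV pV qV (α + t * δ) (β + t * δ) (γ - t * (α - β)) δ) :
    OddReach hQ ys sV pV qV α β γ δ := by
  obtain ⟨η, hη, hηy, hηw⟩ := h
  set G := transvectionA'Equiv hQ (t • (pV + qV)) 0 (apply_smul_add_self hpp hqq hpq hqp t) with hG
  refine ⟨G.trans η, (IsWordIn.of_mem (transvectionA'Equiv_mem_wallGenerators hQ _ _ _)).trans hη,
    fun j => ?_, ?_⟩
  · rw [LinearMap.BilinForm.IsometryEquiv.trans_apply, hG, transvectionA'Equiv_apply,
      (transvection_core_apply_ys hy0 hpy hqy t j).2.2.1, hηy]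
  · rw [LinearMap.BilinForm.IsometryEquiv.trans_apply, hG, transvectionA'Equiv_apply,
      transvectionA'_smul_add_oddNF hpp hqq hpq hqp hps hqs, hηw]

/-- `A'_{t(p-q)}`: reachability of `(α + tδ, β - tδ, γ - t(α+β), δ)` gives that of `(α, β, γ, δ)`.
[cite: Kirby1989, Ch. X, proof of Thm. 2 (p. 62)] -/
theorem OddReach.of_transvectionA'_sub (t : ℤ) {α β γ δ : ℤ}
    (h : OddReach hQ ys sV pV qV (α + t * δ) (β - t * δ) (γ - t * (α + β)) δ) :
    OddReach hQ ys sV pV qV α β γ δ := by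
  obtain ⟨η, hη, hηy, hηw⟩ := h
  set G := transvectionA'Equiv hQ (t • (pV - qV)) 0 (apply_smul_sub_self hpp hqq hpq hqp t) with hG
  refine ⟨G.trans η, (IsWordIn.of_mem (transvectionA'Equiv_mem_wallGenerators hQ _ _ _)).trans hη,
    fun j => ?_, ?_⟩
  · rw [LinearMap.BilinForm.IsometryEquiv.trans_apply, hG, transvectionA'Equiv_apply,
      (transvection_core_apply_ys hy0 hpy hqy t j).2.2.2, hηy]
  · rw [LinearMap.BilinForm.IsometryEquiv.trans_apply, hG, transvectionA'Equiv_apply,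
      transvectionA'_smul_sub_oddNF hpp hqq hpq hqp hps hqs, hηw]

omit hpp hqq hpq hqp hps hqs hpy hqy in
/-- **The base of the descent**: `s + y` is carried to `y` by `A'_{-s}` (as in the even endgame),
`s` being isotropic and orthogonal to the `y_j`. [cite: Kirby1989, Ch. X, proof of Thm. 2 (pp. 61–62)] -/
theorem OddReach.base (hss : Q sV sV = 0) (hsy : ∀ j, Q sV (ys j).1 = 0) :
    OddReach hQ ys sV pV qV 0 0 0 1 := by
  have h0 : Q (-sV) (-sV) = 0 + 0 := by
    simp only [map_neg, LinearMap.neg_apply, neg_neg, hss, add_zero]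
  set T := transvectionA'Equiv hQ (-sV) 0 h0 with hT
  refine ⟨T, IsWordIn.of_mem (transvectionA'Equiv_mem_wallGenerators hQ _ _ _), fun j => ?_, ?_⟩
  · rw [hT, transvectionA'Equiv_apply, hy0 j, transvectionA'_inl, map_neg, LinearMap.neg_apply, hsy,
      neg_zero, zero_smul, sub_zero]
  · rw [hT, transvectionA'Equiv_apply, transvectionA', LinearMap.BilinForm.eichlerTransvection_apply,
      prod_hyperbolic_hypX_oddNF, prod_hyperbolic_inl_oddNF, map_neg, LinearMap.neg_apply, hss]
    simp only [oddNF, neg_zero, zero_mul, add_zero, zero_smul, sub_zero, one_smul]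
    rw [show ((-sV, (0 : Fin 2 → ℤ)) : V × (Fin 2 → ℤ)) = -((sV, 0) : V × (Fin 2 → ℤ)) by
      rw [Prod.neg_mk, neg_zero]]
    abel


/-! ### The Euclidean algorithm on the axes `m = 0` and `m' = 0` -/

variable (hss : Q sV sV = 0) (hsy : ∀ j, Q sV (ys j).1 = 0)
include hss hsy

/-- **The axis `α = β`** (`m = 0`, `δ = 0`): `s + m'(p + q) + γ x` with `(m', γ)` coprime and `γ` odd
is carried to `y` — Euclid's algorithm with `A_{t(p+q)}` (`m' ↦ m' + tγ`) and `A'_{t(p-q)}`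
(`γ ↦ γ - 2t m'`), ending at `m' = 0`, `γ = ±1`. [cite: WallJLMS1964, §2, p. 145] -/
theorem OddReach.axis_add : ∀ (n : ℕ) (m' γ : ℤ), m'.natAbs + γ.natAbs ≤ n → IsCoprime m' γ →
    Odd γ → OddReach hQ ys sV pV qV m' m' γ 0 := by
  intro n
  induction n with
  | zero =>
    intro m' γ hn _ hγ
    exfalso
    have hγ0 : γ = 0 := by omega
    rw [hγ0] at hγ
    exact absurd hγ (by decide)
  | succ n ih =>
    intro m' γ hn hcop hγ
    have hγ0 : γ ≠ 0 := by rintro rfl; exact absurd hγ (by decide)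
    by_cases hm : m' = 0
    · subst hm
      have hu : IsUnit γ := isCoprime_zero_left.1 hcop
      rcases Int.isUnit_iff.1 hu with rfl | rfl
      · exact OddReach.of_swap hy0 (OddReach.base hy0 hss hsy)
      · refine OddReach.of_neg hy0 ?_
        rw [neg_neg, neg_zero]
        exact OddReach.of_swap hy0 (OddReach.base hy0 hss hsy)
    by_cases hlt : m'.natAbs < γ.natAbs
    · -- shorten `γ` by a multiple of `2m'`
      obtain ⟨t, ht⟩ := Int.exists_two_mul_abs_sub_mul_le γ (m' + m') (by omega)
      rw [Int.abs_eq_natAbs, Int.abs_eq_natAbs] at ht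
      set γ' := γ - t * (m' + m') with hγ'
      have hγ'odd : Odd γ' := by
        rw [hγ']
        exact hγ.sub_even ⟨t * m', by ring⟩
      have hcop' : IsCoprime m' γ' := by
        obtain ⟨u, v, huv⟩ := hcop
        exact ⟨u + 2 * t * v, v, by rw [hγ']; linear_combination huv⟩
      have hbound : m'.natAbs + γ'.natAbs ≤ n := by omega
      have h' := ih m' γ' hbound hcop' hγ'odd
      refine OddReach.of_transvectionA'_sub hpp hqq hpq hqp hps hqs hy0 hpy hqy t ?_
      exact h'.congr (by ring) (by ring) (by rw [hγ']) rfl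
    · -- shorten `m'` by a multiple of `γ`
      obtain ⟨t, ht⟩ := Int.exists_two_mul_abs_sub_mul_le m' γ hγ0
      rw [Int.abs_eq_natAbs, Int.abs_eq_natAbs] at ht
      set m'' := m' - t * γ with hm''
      have hcop' : IsCoprime m'' γ := by
        obtain ⟨u, v, huv⟩ := hcop
        exact ⟨u, v + t * u, by rw [hm'']; linear_combination huv⟩
      have hbound : m''.natAbs + γ.natAbs ≤ n := by omega
      have h' := ih m'' γ hbound hcop' hγ
      refine OddReach.of_transvectionA_add hpp hqq hpq hqp hps hqs hy0 hpy hqy (-t) ?_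
      exact h'.congr (by rw [hm'']; ring) (by rw [hm'']; ring) rfl (by ring)

/-- **The axis `α = -β`** (`m' = 0`, `δ = 0`): `s + m(p - q) + γ x` with `(m, γ)` coprime and `γ` odd
is carried to `y` — Euclid's algorithm with `A_{t(p-q)}` (`m ↦ m + tγ`) and `A'_{t(p+q)}`
(`γ ↦ γ - 2t m`). [cite: WallJLMS1964, §2, p. 145] -/
theorem OddReach.axis_sub : ∀ (n : ℕ) (m γ : ℤ), m.natAbs + γ.natAbs ≤ n → IsCoprime m γ →
    Odd γ → OddReach hQ ys sV pV qV m (-m) γ 0 := by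
  intro n
  induction n with
  | zero =>
    intro m γ hn _ hγ
    exfalso
    have hγ0 : γ = 0 := by omega
    rw [hγ0] at hγ
    exact absurd hγ (by decide)
  | succ n ih =>
    intro m γ hn hcop hγ
    have hγ0 : γ ≠ 0 := by rintro rfl; exact absurd hγ (by decide)
    by_cases hm : m = 0
    · subst hm
      have hu : IsUnit γ := isCoprime_zero_left.1 hcop
      rw [neg_zero]
      rcases Int.isUnit_iff.1 hu with rfl | rfl
      · exact OddReach.of_swap hy0 (OddReach.base hy0 hss hsy)
      · refine OddReach.of_neg hy0 ?_
        rw [neg_neg, neg_zero]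
        exact OddReach.of_swap hy0 (OddReach.base hy0 hss hsy)
    by_cases hlt : m.natAbs < γ.natAbs
    · -- shorten `γ` by a multiple of `2m`
      obtain ⟨t, ht⟩ := Int.exists_two_mul_abs_sub_mul_le γ (m + m) (by omega)
      rw [Int.abs_eq_natAbs, Int.abs_eq_natAbs] at ht
      set γ' := γ - t * (m + m) with hγ'
      have hγ'odd : Odd γ' := by
        rw [hγ']
        exact hγ.sub_even ⟨t * m, by ring⟩
      have hcop' : IsCoprime m γ' := by
        obtain ⟨u, v, huv⟩ := hcop
        exact ⟨u + 2 * t * v, v, by rw [hγ']; linear_combination huv⟩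
      have hbound : m.natAbs + γ'.natAbs ≤ n := by omega
      have h' := ih m γ' hbound hcop' hγ'odd
      refine OddReach.of_transvectionA'_add hpp hqq hpq hqp hps hqs hy0 hpy hqy t ?_
      exact h'.congr (by ring) (by ring) (by rw [hγ']; ring) rfl
    · -- shorten `m` by a multiple of `γ`
      obtain ⟨t, ht⟩ := Int.exists_two_mul_abs_sub_mul_le m γ hγ0
      rw [Int.abs_eq_natAbs, Int.abs_eq_natAbs] at ht
      set m'' := m - t * γ with hm''
      have hcop' : IsCoprime m'' γ := by
        obtain ⟨u, v, huv⟩ := hcop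
        exact ⟨u, v + t * u, by rw [hm'']; linear_combination huv⟩
      have hbound : m''.natAbs + γ.natAbs ≤ n := by omega
      have h' := ih m'' γ hbound hcop' hγ
      refine OddReach.of_transvectionA_sub hpp hqq hpq hqp hps hqs hy0 hpy hqy (-t) ?_
      exact h'.congr (by rw [hm'']; ring) (by rw [hm'']; ring) rfl (by ring)

/-! ### The main descent -/

/-- **The descent**: every EVEN-type isotropic normal form with a dual vector (the integer shadow of
"`w` isotropic with an isotropic dual vector `z`, `w·z = 1`": `α² - β² + 2γδ = 0` and
`α α' - β β' + γ δ' + δ γ' = 1` for an isotropic `(α', β', γ', δ')`) is carried to `y` by a word in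
Kirby's generators fixing the `y_j`, provided `γ ≠ 0`: arrange `|m|, |m'| ≤ |γ|/2` by
`A_{t(p∓q)}`, so that `|δ| ≤ |γ|/2`; if `δ = 0` the axes finish, else swap and recurse on `|γ|`.
[cite: WallJLMS1964, §2, p. 145] [cite: Kirby1989, Ch. X, proof of Thm. 2 (pp. 61–62)] -/
theorem OddReach.descent : ∀ (n : ℕ) (α β γ δ : ℤ), γ.natAbs ≤ n → γ ≠ 0 →
    α * α - β * β + 2 * γ * δ = 0 →
    (∃ α' β' γ' δ' : ℤ, α' * α' - β' * β' + 2 * γ' * δ' = 0 ∧ α * α' - β * β' + γ * δ' + δ * γ' = 1) →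
    OddReach hQ ys sV pV qV α β γ δ := by
  intro n
  induction n with
  | zero =>
    intro α β γ δ hn hγ0
    exact absurd (Int.natAbs_eq_zero.1 (Nat.le_zero.1 hn)) hγ0
  | succ n ih =>
    intro α β γ δ hn hγ0 hI hD
    -- `α ≡ β (mod 2)`: `α - β = 2m`, `α + β = 2m'`
    have heven : Even (α - β) := Int.even_sub_of_even_sq_sub_sq ⟨-(γ * δ), by linear_combination hI⟩
    obtain ⟨m, hm⟩ := heven
    obtain ⟨m', hm'⟩ : ∃ m' : ℤ, α + β = m' + m' := ⟨m + β, by linear_combination hm⟩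
    have hα : α = m + m' := by omega
    have hβ : β = m' - m := by omega
    subst hα hβ
    obtain ⟨α', β', γ', δ', hD1, hD2⟩ := hD
    -- step 1: reduce `m'` by a multiple of `γ` (`A_{-t₁(p+q)}`)
    obtain ⟨t₁, ht₁⟩ := Int.exists_two_mul_abs_sub_mul_le m' γ hγ0
    -- step 2: reduce `m` by a multiple of `γ` (`A_{-t₂(p-q)}`)
    obtain ⟨t₂, ht₂⟩ := Int.exists_two_mul_abs_sub_mul_le m γ hγ0
    set r' := m' - t₁ * γ with hr'
    set r := m - t₂ * γ with hr
    -- the last coordinate after the two steps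
    set δ₂ := δ + 2 * t₁ * m + 2 * t₂ * r' with hδ₂
    -- it suffices to reach the new tuple
    suffices h₂ : OddReach hQ ys sV pV qV (r + r') (r' - r) γ δ₂ by
      refine OddReach.of_transvectionA_add hpp hqq hpq hqp hps hqs hy0 hpy hqy (-t₁) ?_
      refine OddReach.of_transvectionA_sub hpp hqq hpq hqp hps hqs hy0 hpy hqy (-t₂) ?_
      exact h₂.congr (by rw [hr, hr']; ring) (by rw [hr, hr']; ring) rfl (by rw [hδ₂, hr']; ring)
    -- invariants of the new tuple
    have hI₂ : (r + r') * (r + r') - (r' - r) * (r' - r) + 2 * γ * δ₂ = 0 := by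
      rw [hr, hr', hδ₂]; linear_combination hI
    have hD₂ : ∃ a b c d : ℤ, a * a - b * b + 2 * c * d = 0 ∧
        (r + r') * a - (r' - r) * b + γ * d + δ₂ * c = 1 := by
      refine ⟨α' - t₁ * γ' - t₂ * γ', β' - t₁ * γ' + t₂ * γ', γ',
        δ' + t₁ * (α' - β') + t₂ * ((α' - t₁ * γ') + (β' - t₁ * γ')), ?_, ?_⟩
      · linear_combination hD1
      · rw [hr, hr', hδ₂]; linear_combination hD2
    -- the bound `2|δ₂| ≤ |γ|` from `γ δ₂ = -2 r r'`, `2|r|, 2|r'| ≤ |γ|`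
    have hprod : γ * δ₂ = -2 * (r * r') := by
      have h2 : (2 : ℤ) * (γ * δ₂ + 2 * (r * r')) = 0 := by linear_combination hI₂
      have h3 := (mul_eq_zero.1 h2).resolve_left two_ne_zero
      linear_combination h3
    have hbound : 2 * |δ₂| ≤ |γ| := by
      have hγpos : 0 < |γ| := abs_pos.2 hγ0
      have h4 : 2 * |r| * (2 * |r'|) ≤ |γ| * |γ| :=
        mul_le_mul ht₂ ht₁ (by positivity) (abs_nonneg _)
      have habs : |γ| * |δ₂| = 2 * (|r| * |r'|) := by
        rw [← abs_mul, hprod, abs_mul, abs_mul, abs_neg, abs_two]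
      refine le_of_mul_le_mul_left ?_ hγpos
      calc |γ| * (2 * |δ₂|) = 2 * (|γ| * |δ₂|) := by ring
        _ = 2 * |r| * (2 * |r'|) := by rw [habs]; ring
        _ ≤ |γ| * |γ| := h4
    by_cases hδ0 : δ₂ = 0
    · -- on an axis
      rw [hδ0] at hI₂ hD₂ ⊢
      have hrr : r * r' = 0 := by
        have h := hprod
        rw [hδ0, mul_zero] at h
        rcases mul_eq_zero.1 h.symm with h2 | h2
        · norm_num at h2
        · exact h2
      obtain ⟨a, b, c, d, hab, hpair⟩ := hD₂
      have hab' : Even (a - b) := Int.even_sub_of_even_sq_sub_sq ⟨-(c * d), by linear_combination hab⟩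
      rcases mul_eq_zero.1 hrr with h0 | h0
      · -- `r = 0`: the axis `α = β = r'`
        rw [h0, zero_add, sub_zero] at hpair ⊢
        have hcop : IsCoprime r' γ := ⟨a - b, d, by linear_combination hpair⟩
        have hγodd : Odd γ := by
          have h1 : Odd (r' * (a - b) + γ * d) := by
            rw [show r' * (a - b) + γ * d = 1 by linear_combination hpair]; exact odd_one
          have h2 : Even (r' * (a - b)) := hab'.mul_left r'
          have h3 : Odd (γ * d) := by
            rw [show γ * d = (r' * (a - b) + γ * d) - r' * (a - b) by ring]
            exact h1.sub_even h2
          exact (Int.odd_mul.1 h3).1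
        exact OddReach.axis_add hpp hqq hpq hqp hps hqs hy0 hpy hqy hss hsy _ r' γ le_rfl hcop hγodd
      · -- `r' = 0`: the axis `α = -β = r`
        rw [h0, add_zero, zero_sub] at hpair ⊢
        have hcop : IsCoprime r γ := ⟨a + b, d, by linear_combination hpair⟩
        have hγodd : Odd γ := by
          have hab'' : Even (a + b) := by
            rw [show a + b = (a - b) + 2 * b by ring]; exact hab'.add (even_two_mul b)
          have h1 : Odd (r * (a + b) + γ * d) := by
            rw [show r * (a + b) + γ * d = 1 by linear_combination hpair]; exact odd_one
          have h2 : Even (r * (a + b)) := hab''.mul_left r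
          have h3 : Odd (γ * d) := by
            rw [show γ * d = (r * (a + b) + γ * d) - r * (a + b) by ring]
            exact h1.sub_even h2
          exact (Int.odd_mul.1 h3).1
        exact OddReach.axis_sub hpp hqq hpq hqp hps hqs hy0 hpy hqy hss hsy _ r γ le_rfl hcop hγodd
    · -- swap and recurse on `|γ|`
      refine OddReach.of_swap hy0 (ih _ _ _ _ ?_ hδ0 (by linear_combination hI₂) ?_)
      · rw [Int.abs_eq_natAbs, Int.abs_eq_natAbs] at hbound
        omega
      · obtain ⟨a, b, c, d, hab, hpair⟩ := hD₂
        exact ⟨a, b, d, c, by linear_combination hab, by linear_combination hpair⟩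

omit hpp hqq hpq hqp hps hqs hy0 hpy hqy hss hsy in
/-- No isotropic vector with an isotropic dual has `γ = δ = 0` (it would be the ODD-type
`±(p ± q)`). [folklore] -/
theorem false_of_oddNF_invariants_zero_zero {α β : ℤ} (hI : α * α - β * β + 2 * 0 * 0 = 0)
    (hD : ∃ α' β' γ' δ' : ℤ, α' * α' - β' * β' + 2 * γ' * δ' = 0 ∧
      α * α' - β * β' + 0 * δ' + 0 * γ' = 1) : False := by
  obtain ⟨a, b, c, d, hab, hpair⟩ := hD
  have hab' : Even (a - b) := Int.even_sub_of_even_sq_sub_sq ⟨-(c * d), by linear_combination hab⟩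
  have hab'' : Even (a + b) := by
    rw [show a + b = (a - b) + 2 * b by ring]; exact hab'.add (even_two_mul b)
  have hprod : (α - β) * (α + β) = 0 := by linear_combination hI
  rcases mul_eq_zero.1 hprod with h | h
  · have hαβ : α = β := by linear_combination h
    rw [hαβ] at hpair
    have h1 : Odd (β * (a - b)) := by
      rw [show β * (a - b) = 1 by linear_combination hpair]; exact odd_one
    exact ((Int.not_even_iff_odd.2 (Int.odd_mul.1 h1).2) hab').elim
  · have hαβ : α = -β := by linear_combination h
    rw [hαβ] at hpair
    have h1 : Odd (-β * (a + b)) := by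
      rw [show -β * (a + b) = 1 by linear_combination hpair]; exact odd_one
    exact ((Int.not_even_iff_odd.2 (Int.odd_mul.1 h1).2) hab'').elim

/-- **The odd endgame** (module docstring): the vector `s + α p + β q + γ x + δ y` of `Q ⊕ H` —
`s` isotropic and orthogonal to `p`, `q`, `H` and to the placed isotropic `y_j`, and
`p·p = 1`, `q·q = -1`, `p·q = 0` — whose coefficients satisfy the isotropy relation
`α² - β² + 2γδ = 0` and admit a dual tuple (`α α' - β β' + γ δ' + δ γ' = 1` with
`α'² - β'² + 2γ'δ' = 0`), is carried to `y` by a word in Kirby's generators `wallGenerators` that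
fixes every `y_j`. [cite: WallJLMS1964, §2, p. 145] [cite: Kirby1989, Ch. X, proof of Thm. 2 (pp. 61–62)] -/
theorem exists_isWordIn_wallGenerators_endgame_odd (α β γ δ : ℤ)
    (hI : α * α - β * β + 2 * γ * δ = 0)
    (hD : ∃ α' β' γ' δ' : ℤ, α' * α' - β' * β' + 2 * γ' * δ' = 0 ∧
      α * α' - β * β' + γ * δ' + δ * γ' = 1) :
    ∃ η : (QH).IsometryEquiv QH, IsWordIn (wallGenerators hQ) η ∧ (∀ j, η (ys j) = ys j) ∧
      η (oddNF sV pV qV α β γ δ) = hypY := by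
  by_cases hγ0 : γ = 0
  · by_cases hδ0 : δ = 0
    · subst hγ0 hδ0
      exact (false_of_oddNF_invariants_zero_zero hI hD).elim
    · subst hγ0
      refine OddReach.of_swap hy0 (OddReach.descent hpp hqq hpq hqp hps hqs hy0 hpy hqy hss hsy _
        α β δ 0 le_rfl hδ0 (by linear_combination hI) ?_)
      obtain ⟨a, b, c, d, hab, hpair⟩ := hD
      exact ⟨a, b, d, c, by linear_combination hab, by linear_combination hpair⟩
  · exact OddReach.descent hpp hqq hpq hqp hps hqs hy0 hpy hqy hss hsy _ α β γ δ le_rfl hγ0 hI hD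

end Endgame


/-! ### Full frames over the odd core -/

section FullFrameOdd

/-- **Transport of a FULL hyperbolic frame onto the standard one by words in Kirby's generators,
over the odd core `⟨1⟩ ⊕ ⟨-1⟩`** (the odd companion of
`exists_isWordIn_wallGenerators_apply_eq_std_of_fullFrame`).  In `Q ⊕ H` let
`(x_j, y_j)_{j<K}` be pairwise orthogonal hyperbolic pairs orthogonal to `H`, and `p`, `q`
vectors of the summand `Q` with `p·p = 1`, `q·q = -1`, `p·q = 0`, orthogonal to the planes, such
that the planes, `H`, `p` and `q` exhaust the lattice (`hspan`) — e.g.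
`Q ≅ ⟨1⟩ ⊕ ⟨-1⟩ ⊕ K·H` with its planes.  Then the isotropic half `u` of every hyperbolic
`(K+1)`-frame `(u, u')` is carried onto `(y_0, …, y_{K-1}, y)` by a word in `wallGenerators`:
the first `K` vectors by the frame transport of the target planes with `H` as the auxiliary pair
(`exists_isWordIn_planeGens_apply_eq`), after which the last vector is
`s + α p + β q + γ x + δ y` (`s = Σ (w·x_i) y_i`), isotropic with an isotropic dual of the same
shape, and the odd endgame (`exists_isWordIn_wallGenerators_endgame_odd`) finishes.
[cite: WallJLMS1964, §2, p. 145] [cite: Kirby1989, Ch. X, proof of Thm. 2 (pp. 61–62)]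
[cite: GritsenkoHulekSankaran2009, Prop. 3.3 (i), (ii)] -/
theorem exists_isWordIn_wallGenerators_apply_eq_std_of_fullFrame_odd (hQ : Q.IsSymm) {K : ℕ}
    {xs ys : Fin K → V × (Fin 2 → ℤ)}
    (hxx : ∀ i j, QH (xs i) (xs j) = 0) (hyy : ∀ i j, QH (ys i) (ys j) = 0)
    (hxy : ∀ i j, QH (xs i) (ys j) = if i = j then 1 else 0)
    (hxX : ∀ j, QH (xs j) hypX = 0) (hxY : ∀ j, QH (xs j) hypY = 0)
    (hyX : ∀ j, QH (ys j) hypX = 0) (hyY : ∀ j, QH (ys j) hypY = 0)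
    {pV qV : V} (hpp : Q pV pV = 1) (hqq : Q qV qV = -1) (hpq : Q pV qV = 0)
    (hpx : ∀ j, QH ((pV, 0) : V × (Fin 2 → ℤ)) (xs j) = 0)
    (hpy : ∀ j, QH ((pV, 0) : V × (Fin 2 → ℤ)) (ys j) = 0)
    (hqx : ∀ j, QH ((qV, 0) : V × (Fin 2 → ℤ)) (xs j) = 0)
    (hqy : ∀ j, QH ((qV, 0) : V × (Fin 2 → ℤ)) (ys j) = 0)
    (hspan : ∀ v : V × (Fin 2 → ℤ), (∀ j, QH v (xs j) = 0) → (∀ j, QH v (ys j) = 0) →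
      QH v hypX = 0 → QH v hypY = 0 → QH v ((pV, 0) : V × (Fin 2 → ℤ)) = 0 →
      QH v ((qV, 0) : V × (Fin 2 → ℤ)) = 0 → v = 0)
    (u u' : Fin (K + 1) → V × (Fin 2 → ℤ))
    (hu : ∀ i j, QH (u i) (u j) = 0) (hu' : ∀ i j, QH (u' i) (u' j) = 0)
    (huu' : ∀ i j, QH (u i) (u' j) = if i = j then 1 else 0) :
    ∃ φ : (QH).IsometryEquiv QH, IsWordIn (wallGenerators hQ) φ ∧
      (∀ i : Fin K, φ (u (Fin.castSucc i)) = ys i) ∧ φ (u (Fin.last K)) = hypY := by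
  have hB : (QH).IsSymm := hQ.prod isSymm_hyperbolicForm
  -- notation for the core vectors
  set p : V × (Fin 2 → ℤ) := (pV, 0) with hpdef
  set q : V × (Fin 2 → ℤ) := (qV, 0) with hqdef
  have hppQ : QH p p = 1 := by rw [hpdef, prod_hyperbolic_inl_inl, hpp]
  have hqqQ : QH q q = -1 := by rw [hqdef, prod_hyperbolic_inl_inl, hqq]
  have hpqQ : QH p q = 0 := by rw [hpdef, hqdef, prod_hyperbolic_inl_inl, hpq]
  have hqpQ : QH q p = 0 := by rw [hB.eq, hpqQ]
  have hpXQ : QH p hypX = 0 := prod_hyperbolic_inl_hypX Q _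
  have hpYQ : QH p hypY = 0 := prod_hyperbolic_inl_hypY Q _
  have hqXQ : QH q hypX = 0 := prod_hyperbolic_inl_hypX Q _
  have hqYQ : QH q hypY = 0 := prod_hyperbolic_inl_hypY Q _
  -- the transvections of the target planes are words in the generators
  have hgens : ∀ ψ ∈ planeGens QH xs ys, IsWordIn (wallGenerators hQ) ψ := by
    intro ψ hψ
    cases K with
    | zero =>
      obtain ⟨j, -⟩ := hψ
      exact j.elim0
    | succ K =>
      have h₀ : TwoHyperbolicPairs QH hypX hypY (xs 0) (ys 0) :=
        { isSymm := hB
          xx := prod_hyperbolic_hypX_hypX Q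
          yy := prod_hyperbolic_hypY_hypY Q
          xy := prod_hyperbolic_hypX_hypY Q
          x₁x₁ := hxx 0 0
          y₁y₁ := hyy 0 0
          x₁y₁ := by rw [hxy, if_pos rfl]
          xx₁ := by rw [hB.eq, hxX]
          xy₁ := by rw [hB.eq, hyX]
          yx₁ := by rw [hB.eq, hxY]
          yy₁ := by rw [hB.eq, hyY] }
      exact isWordIn_wallGenerators_of_mem_planeGens hQ h₀ (fun j => hxx j j) (fun j => hyy j j)
        (fun j => by rw [hxy, if_pos rfl]) hψ
  -- place the first `K` vectors, `H` being the auxiliary pair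
  obtain ⟨φ, hφ, hφu⟩ := exists_isWordIn_planeGens_apply_eq hB hxx hyy hxy
    (prod_hyperbolic_hypX_hypX Q) (prod_hyperbolic_hypY_hypY Q) (prod_hyperbolic_hypX_hypY Q)
    hxX hxY hyX hyY (fun i => u (Fin.castSucc i)) (fun i => u' (Fin.castSucc i))
    (fun i j => hu _ _) (fun i j => hu' _ _)
    (fun i j => by simp only [huu', Fin.castSucc_inj])
  -- sums along the `y_i`
  have hSy : ∀ (c : Fin K → ℤ) j, QH (∑ i, c i • ys i) (ys j) = 0 := fun c j => by
    rw [LinearMap.BilinForm.sum_left]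
    exact Finset.sum_eq_zero fun i _ => by rw [LinearMap.BilinForm.smul_left, hyy, mul_zero]
  have hSv : ∀ (c : Fin K → ℤ) (v : V × (Fin 2 → ℤ)), (∀ i, QH v (ys i) = 0) →
      QH (∑ i, c i • ys i) v = 0 := fun c v hv => by
    rw [LinearMap.BilinForm.sum_left]
    exact Finset.sum_eq_zero fun i _ => by
      rw [LinearMap.BilinForm.smul_left, hB.eq, hv, mul_zero]
  have hSX : ∀ c : Fin K → ℤ, QH (∑ i, c i • ys i) hypX = 0 := fun c =>
    hSv c hypX fun i => by rw [hB.eq]; exact hyX i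
  have hSY : ∀ c : Fin K → ℤ, QH (∑ i, c i • ys i) hypY = 0 := fun c =>
    hSv c hypY fun i => by rw [hB.eq]; exact hyY i
  have hSp : ∀ c : Fin K → ℤ, QH (∑ i, c i • ys i) p = 0 := fun c => hSv c p fun i => hpy i
  have hSq : ∀ c : Fin K → ℤ, QH (∑ i, c i • ys i) q = 0 := fun c => hSv c q fun i => hqy i
  have hSx : ∀ (c : Fin K → ℤ) j, QH (∑ i, c i • ys i) (xs j) = c j := fun c j => by
    rw [LinearMap.BilinForm.sum_left, Finset.sum_eq_single j]
    · rw [LinearMap.BilinForm.smul_left, hB.eq, hxy, if_pos rfl, mul_one]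
    · intro i _ hij
      rw [LinearMap.BilinForm.smul_left, hB.eq, hxy, if_neg (Ne.symm hij), mul_zero]
    · intro h; exact absurd (Finset.mem_univ j) h
  -- expansion of a vector orthogonal to the `y_i`
  have hexp : ∀ v : V × (Fin 2 → ℤ), (∀ i, QH v (ys i) = 0) →
      v = ∑ i, QH v (xs i) • ys i + QH v p • p + (-QH v q) • q + QH v hypY • hypX +
        QH v hypX • hypY := by
    intro v hv
    rw [← sub_eq_zero]
    refine hspan _ (fun j => ?_) (fun j => ?_) ?_ ?_ ?_ ?_
    · simp only [map_sub, map_add, map_smul, LinearMap.sub_apply, LinearMap.add_apply,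
        LinearMap.smul_apply, smul_eq_mul, hSx, hpx, hqx, hB.eq hypX (xs j), hxX, hB.eq hypY (xs j),
        hxY]
      ring
    · simp only [map_sub, map_add, map_smul, LinearMap.sub_apply, LinearMap.add_apply,
        LinearMap.smul_apply, smul_eq_mul, hSy, hv, hpy, hqy, hB.eq hypX (ys j), hyX,
        hB.eq hypY (ys j), hyY]
      ring
    · simp only [map_sub, map_add, map_smul, LinearMap.sub_apply, LinearMap.add_apply,
        LinearMap.smul_apply, smul_eq_mul, hSX, hpXQ, hqXQ, prod_hyperbolic_hypX_hypX,
        prod_hyperbolic_hypY_hypX]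
      ring
    · simp only [map_sub, map_add, map_smul, LinearMap.sub_apply, LinearMap.add_apply,
        LinearMap.smul_apply, smul_eq_mul, hSY, hpYQ, hqYQ, prod_hyperbolic_hypX_hypY,
        prod_hyperbolic_hypY_hypY]
      ring
    · simp only [map_sub, map_add, map_smul, LinearMap.sub_apply, LinearMap.add_apply,
        LinearMap.smul_apply, smul_eq_mul, hSp, hppQ, hqpQ, hB.eq hypX p, hpXQ, hB.eq hypY p, hpYQ]
      ring
    · simp only [map_sub, map_add, map_smul, LinearMap.sub_apply, LinearMap.add_apply,
        LinearMap.smul_apply, smul_eq_mul, hSq, hpqQ, hqqQ, hB.eq hypX q, hqXQ, hB.eq hypY q, hqYQ]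
      ring
  -- the pairing of two vectors orthogonal to the `y_i`
  have hpair : ∀ v v' : V × (Fin 2 → ℤ), (∀ i, QH v (ys i) = 0) → (∀ i, QH v' (ys i) = 0) →
      QH v v' = QH v p * QH v' p - QH v q * QH v' q + QH v hypY * QH v' hypX +
        QH v hypX * QH v' hypY := by
    intro v v' hv hv'
    conv_lhs => rw [hexp v hv]
    simp only [map_add, map_smul, LinearMap.add_apply, LinearMap.smul_apply, smul_eq_mul, hSv _ v' hv',
      hB.eq p v', hB.eq q v', hB.eq hypX v', hB.eq hypY v']
    ring
  -- the last vector `w` and its dual `z`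
  set w := φ (u (Fin.last K)) with hwdef
  set z := φ (u' (Fin.last K)) with hzdef
  have hne : ∀ i : Fin K, Fin.castSucc i ≠ Fin.last K := fun i => (Fin.castSucc_lt_last i).ne
  have hwy : ∀ i, QH w (ys i) = 0 := fun i => by
    rw [hwdef, ← hφu i, φ.map_app, hu]
  have hzy : ∀ i, QH z (ys i) = 0 := fun i => by
    rw [hzdef, ← hφu i, φ.map_app, hB.eq, huu', if_neg (hne i)]
  have hww : QH w w = 0 := by rw [hwdef, φ.map_app, hu]
  have hzz : QH z z = 0 := by rw [hzdef, φ.map_app, hu']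
  have hwz : QH w z = 1 := by rw [hwdef, hzdef, φ.map_app, huu', if_pos rfl]
  have hw : w = ∑ i, QH w (xs i) • ys i + QH w p • p + (-QH w q) • q + QH w hypY • hypX +
      QH w hypX • hypY := hexp w hwy
  -- the sum along the `y_i` lies in the summand `Q`
  set sV : V := (∑ i, QH w (xs i) • ys i).1 with hsVdef
  have hs : (∑ i, QH w (xs i) • ys i) = ((sV, 0) : V × (Fin 2 → ℤ)) :=
    eq_inl_fst_of_ortho_hyp (hSX _) (hSY _)
  have hy0 : ∀ j, ys j = ((ys j).1, 0) := fun j => eq_inl_fst_of_ortho_hyp (hyX j) (hyY j)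
  have hx0 : ∀ j, xs j = ((xs j).1, 0) := fun j => eq_inl_fst_of_ortho_hyp (hxX j) (hxY j)
  -- the `V`-forms of the orthogonality relations
  have hqp' : Q qV pV = 0 := by rw [hQ.eq, hpq]
  have hps' : Q pV sV = 0 := by
    have h := hSp (fun i => QH w (xs i)); rw [hs, hB.eq, hpdef, prod_hyperbolic_inl_inl] at h; exact h
  have hqs' : Q qV sV = 0 := by
    have h := hSq (fun i => QH w (xs i)); rw [hs, hB.eq, hqdef, prod_hyperbolic_inl_inl] at h; exact h
  have hpy' : ∀ j, Q pV (ys j).1 = 0 := fun j => by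
    have h := hpy j; rw [hy0 j, hpdef, prod_hyperbolic_inl_inl] at h; exact h
  have hqy' : ∀ j, Q qV (ys j).1 = 0 := fun j => by
    have h := hqy j; rw [hy0 j, hqdef, prod_hyperbolic_inl_inl] at h; exact h
  have hss' : Q sV sV = 0 := by
    have h := hSv (fun i => QH w (xs i)) (∑ i, QH w (xs i) • ys i) (hSy _)
    rw [hs, prod_hyperbolic_inl_inl] at h; exact h
  have hsy' : ∀ j, Q sV (ys j).1 = 0 := fun j => by
    have h := hSy (fun i => QH w (xs i)) j; rw [hs, hy0 j, prod_hyperbolic_inl_inl] at h; exact h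
  -- the integer invariants of `w`
  have hI : QH w p * QH w p - (-QH w q) * (-QH w q) + 2 * QH w hypY * QH w hypX = 0 := by
    have h := hpair w w hwy hwy
    rw [hww] at h
    linear_combination -h
  have hD : ∃ α' β' γ' δ' : ℤ, α' * α' - β' * β' + 2 * γ' * δ' = 0 ∧
      QH w p * α' - (-QH w q) * β' + QH w hypY * δ' + QH w hypX * γ' = 1 := by
    refine ⟨QH z p, -QH z q, QH z hypY, QH z hypX, ?_, ?_⟩
    · have h := hpair z z hzy hzy
      rw [hzz] at h
      linear_combination -h
    · have h := hpair w z hwy hzy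
      rw [hwz] at h
      linear_combination -h
  -- the odd endgame
  obtain ⟨η, hη, hηy, hηw⟩ := exists_isWordIn_wallGenerators_endgame_odd (hQ := hQ) (ys := ys)
    hpp hqq hpq hqp' hps' hqs' hy0 hpy' hqy' hss' hsy' (QH w p) (-QH w q) (QH w hypY) (QH w hypX) hI hD
  have hw' : w = oddNF sV pV qV (QH w p) (-QH w q) (QH w hypY) (QH w hypX) := by
    rw [oddNF, ← hs, ← hpdef, ← hqdef]; exact hw
  refine ⟨φ.trans η, hφ.bind hgens |>.trans hη, fun i => ?_, ?_⟩
  · rw [LinearMap.BilinForm.IsometryEquiv.trans_apply, hφu, hηy]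
  · rw [LinearMap.BilinForm.IsometryEquiv.trans_apply, ← hwdef, hw', hηw]

/-- **What the regluing and the Lagrangian mover consume, over the odd core `⟨1⟩ ⊕ ⟨-1⟩`**:
under the hypotheses of `exists_isWordIn_wallGenerators_apply_eq_std_of_fullFrame_odd`, for every
isometry `A` of `Q ⊕ H` and every hyperbolic `(K+1)`-frame `(u, u')` there is a word `φ` in
Kirby's generators with `φ (u i) = A (u i)` for all `i` (transport `u` and `A u` onto the standard
half-frame and compose). [cite: Kirby1989, Ch. X, proof of Thm. 1 (p. 56), proof of Thm. 2 (pp. 61–62)]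
[cite: WallJLMS1964, §2, p. 145] -/
theorem exists_isWordIn_wallGenerators_apply_eq_of_fullFrame_odd (hQ : Q.IsSymm) {K : ℕ}
    {xs ys : Fin K → V × (Fin 2 → ℤ)}
    (hxx : ∀ i j, QH (xs i) (xs j) = 0) (hyy : ∀ i j, QH (ys i) (ys j) = 0)
    (hxy : ∀ i j, QH (xs i) (ys j) = if i = j then 1 else 0)
    (hxX : ∀ j, QH (xs j) hypX = 0) (hxY : ∀ j, QH (xs j) hypY = 0)
    (hyX : ∀ j, QH (ys j) hypX = 0) (hyY : ∀ j, QH (ys j) hypY = 0)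
    {pV qV : V} (hpp : Q pV pV = 1) (hqq : Q qV qV = -1) (hpq : Q pV qV = 0)
    (hpx : ∀ j, QH ((pV, 0) : V × (Fin 2 → ℤ)) (xs j) = 0)
    (hpy : ∀ j, QH ((pV, 0) : V × (Fin 2 → ℤ)) (ys j) = 0)
    (hqx : ∀ j, QH ((qV, 0) : V × (Fin 2 → ℤ)) (xs j) = 0)
    (hqy : ∀ j, QH ((qV, 0) : V × (Fin 2 → ℤ)) (ys j) = 0)
    (hspan : ∀ v : V × (Fin 2 → ℤ), (∀ j, QH v (xs j) = 0) → (∀ j, QH v (ys j) = 0) →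
      QH v hypX = 0 → QH v hypY = 0 → QH v ((pV, 0) : V × (Fin 2 → ℤ)) = 0 →
      QH v ((qV, 0) : V × (Fin 2 → ℤ)) = 0 → v = 0)
    (A : (QH).IsometryEquiv QH) (u u' : Fin (K + 1) → V × (Fin 2 → ℤ))
    (hu : ∀ i j, QH (u i) (u j) = 0) (hu' : ∀ i j, QH (u' i) (u' j) = 0)
    (huu' : ∀ i j, QH (u i) (u' j) = if i = j then 1 else 0) :
    ∃ φ : (QH).IsometryEquiv QH, IsWordIn (wallGenerators hQ) φ ∧ ∀ i, φ (u i) = A (u i) := by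
  obtain ⟨φ₁, hφ₁, hφ₁u, hφ₁l⟩ := exists_isWordIn_wallGenerators_apply_eq_std_of_fullFrame_odd hQ hxx
    hyy hxy hxX hxY hyX hyY hpp hqq hpq hpx hpy hqx hqy hspan u u' hu hu' huu'
  obtain ⟨φ₂, hφ₂, hφ₂u, hφ₂l⟩ := exists_isWordIn_wallGenerators_apply_eq_std_of_fullFrame_odd hQ hxx
    hyy hxy hxX hxY hyX hyY hpp hqq hpq hpx hpy hqx hqy hspan (fun i => A (u i)) (fun i => A (u' i))
    (fun i j => by rw [A.map_app, hu]) (fun i j => by rw [A.map_app, hu'])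
    (fun i j => by rw [A.map_app, huu'])
  refine ⟨φ₁.trans φ₂.symm, hφ₁.trans hφ₂.symm, fun i => ?_⟩
  rw [LinearMap.BilinForm.IsometryEquiv.trans_apply]
  induction i using Fin.lastCases with
  | last =>
    rw [hφ₁l, ← hφ₂l, LinearMap.BilinForm.IsometryEquiv.symm_apply_apply]
  | cast i =>
    rw [hφ₁u, ← hφ₂u i, LinearMap.BilinForm.IsometryEquiv.symm_apply_apply]

end FullFrameOdd

end Literature.Topology.FourManifolds

end
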